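import Summits.Ventures.PercRepro.S1TrianglePlusFour

/-!
# PercRepro — LEMMA T⁺⁺⁺: the triangle count at nullity `≥ 4` under the line and plane bounds (p1, gen 20)

Under (C1) and (C2), for nullity `ν ≥ 4`: `2·s₃ + 3ν ≤ ν² + 6`, i.e. `s₃ ≤ 5 + (ν − 4)(ν + 1)/2`
`= 5 · 8 · 12 · 17 · 23 · 30 · 38` at `ν = 4 … 10` (LEMMA T⁺⁺: `6 · 9 · 13 · 18 · 24 · 31 · 39`; the engine's
core maxima `5 · 7` at `ν = 4, 5`; `K₅` has `10` at `ν = 6`).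

PROOF (deletion induction on `|E|`, base `ν = 4` = `ncard_triangles_le_five_of_nullity_four`). For `ν ≥ 5` and a
point `x` on a triangle with `t` triangles through it: if `t ≥ ν − 1` then `s₃ ≤ ν + 1`
(`ncard_triangles_le_succ_of_degree`) and `2(ν + 1) + 3ν ≤ ν² + 6` (`(ν − 1)(ν − 4) ≥ 0`); otherwise
`s₃ ≤ t + s₃(M ＼ {x}) ≤ (ν − 2) + s₃(M ＼ {x})` with `M ＼ {x}` of nullity `ν − 1 ≥ 4`, and
`2(ν − 2) + (ν − 1)² + 6 − 3(ν − 1) + 3ν = ν² + 6`.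

* **`two_mul_ncard_triangles_add_three_mul_le_of_four_le`** — `4 ≤ d → 2·#(triangles M) + 3d ≤ d·d + 6`;
* `ncard_triangles_le_of_nullity_sharp` — the same as `#(triangles M) ≤ (d·d + 6 − 3d) / 2`.
Axioms: standard.
-/

open scoped Matroid

namespace PercRepro

namespace S1

open Set

variable {α : Type}

/-- The quadratic slack: `5d + 2 ≤ d² + 6` for `d ≥ 4` (`(d − 1)(d − 4) ≥ 0`). -/
theorem five_mul_add_two_le_sq_add_six (d : ℕ) (hd : 4 ≤ d) : 5 * d + 2 ≤ d * d + 6 := by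
  obtain ⟨m, rfl⟩ : ∃ m, d = m + 4 := ⟨d - 4, by omega⟩
  nlinarith [Nat.zero_le (m * m)]

/-- **LEMMA T⁺⁺⁺.** If `|E| = r(E) + d` with `d ≥ 4`, every rank-`2` set has `≤ 3` points and every set of rank
`≤ 3` has `≤ 6` points, then `2·#(triangles M) + 3d ≤ d·d + 6`, i.e. `#(triangles M) ≤ 5 + (d − 4)(d + 1)/2`. -/
theorem two_mul_ncard_triangles_add_three_mul_le_of_four_le (M : Matroid α) [M.Finite]
    (hC1 : ∀ L ⊆ M.E, M.eRk L = 2 → L.ncard ≤ 3) (hC2 : ∀ P ⊆ M.E, M.eRk P ≤ 3 → P.ncard ≤ 6)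
    {d : ℕ} (hd4 : 4 ≤ d) (hd : M.E.encard = M.eRank + d) :
    2 * (ThmN.triangles M).ncard + 3 * d ≤ d * d + 6 := by
  suffices H : ∀ n : ℕ, ∀ (M : Matroid α) [M.Finite], M.E.ncard = n →
      (∀ L ⊆ M.E, M.eRk L = 2 → L.ncard ≤ 3) → (∀ P ⊆ M.E, M.eRk P ≤ 3 → P.ncard ≤ 6) →
      ∀ d : ℕ, 4 ≤ d → M.E.encard = M.eRank + d →
      2 * (ThmN.triangles M).ncard + 3 * d ≤ d * d + 6 from H _ M rfl hC1 hC2 d hd4 hd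
  intro n
  induction n using Nat.strong_induction_on with
  | _ n ih =>
  intro M _ hn hC1 hC2 d hd4 hd
  classical
  -- the base `d = 4`
  by_cases hd4' : d = 4
  · subst hd4'
    have := ncard_triangles_le_five_of_nullity_four M hC1 hC2 hd
    omega
  have hd5 : 5 ≤ d := by omega
  set S := ThmN.triangles M with hS
  have hSfin : S.Finite :=
    M.ground_finite.finite_subsets.subset (fun C hC => hC.1.subset_ground)
  have hdd : 3 * d ≤ d * d + 6 := by nlinarith
  by_cases hSe : S = ∅
  · rw [hSe, ncard_empty]; omega
  obtain ⟨C₀, hC₀⟩ := nonempty_iff_ne_empty.2 hSe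
  obtain ⟨e, heC₀⟩ := hC₀.1.nonempty
  have heE : e ∈ M.E := hC₀.1.subset_ground heC₀
  have hx : M.IsNonloop e := by
    refine _root_.Matroid.isNonloop_of_not_isLoop heE ?_
    intro hloop
    have hC₀e : C₀ = {e} := hloop.eq_of_isCircuit_mem hC₀.1 heC₀
    have := hC₀.2
    rw [hC₀e, ncard_singleton] at this
    omega
  set S₁ := ThmN.trianglesThrough M e with hS₁
  have hS₁fin : S₁.Finite := hSfin.subset (fun C hC => ⟨hC.1, hC.2.1⟩)
  -- CASE 1: `t ≥ d − 1`
  by_cases hbig : d ≤ S₁.ncard + 1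
  · have h : S.ncard ≤ d + 1 := ncard_triangles_le_succ_of_degree M hC1 hC2 hd hx hbig
    have key := five_mul_add_two_le_sq_add_six d hd4
    omega
  -- CASE 2: `t ≤ d − 2` — delete `e`
  have h1' : S₁.ncard + 2 ≤ d := by omega
  set S₂ := {C | M.IsCircuit C ∧ C.ncard = 3 ∧ e ∉ C} with hS₂
  have hsplit : S ⊆ S₁ ∪ S₂ := by
    intro C hC
    by_cases h : e ∈ C
    · exact Or.inl ⟨hC.1, hC.2, h⟩
    · exact Or.inr ⟨hC.1, hC.2, h⟩
  have hS₂fin : S₂.Finite := hSfin.subset (fun C hC => ⟨hC.1, hC.2.1⟩)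
  have h3 : S.ncard ≤ S₁.ncard + S₂.ncard := by
    calc S.ncard ≤ (S₁ ∪ S₂).ncard := ncard_le_ncard hsplit (hS₁fin.union hS₂fin)
      _ ≤ S₁.ncard + S₂.ncard := ncard_union_le _ _
  have hne : ¬ M.IsColoop e := hC₀.1.not_isColoop_of_mem heC₀
  have hν : M✶.eRank = (d : ℕ∞) := by
    have h := _root_.Matroid.eRank_add_eRank_dual M
    rw [hd] at h
    exact WithTop.add_left_cancel (PercRepro.Matroid.eRank_ne_top_of_finite M) h
  have hdel := PercRepro.Matroid.dual_eRank_delete_singleton_add_one heE hne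
  rw [hν] at hdel
  have hfin' : (M ＼ {e})✶.eRank ≠ ⊤ := by
    intro h
    rw [h] at hdel
    exact absurd hdel (by simp)
  obtain ⟨d', hd'⟩ := ENat.ne_top_iff_exists.1 hfin'
  have hdd' : d = d' + 1 := by
    rw [← hd'] at hdel
    exact_mod_cast hdel.symm
  have hd'enc : (M ＼ {e}).E.encard = (M ＼ {e}).eRank + d' := by
    have h := _root_.Matroid.eRank_add_eRank_dual (M ＼ {e})
    rw [← hd'] at h
    exact h.symm
  have hdelE : (M ＼ {e}).E.ncard < n := by
    rw [_root_.Matroid.delete_ground, ← hn, ← ncard_sdiff_singleton_add_one heE M.ground_finite]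
    omega
  have hC1' : ∀ L ⊆ (M ＼ {e}).E, (M ＼ {e}).eRk L = 2 → L.ncard ≤ 3 := by
    intro L hL hr
    rw [_root_.Matroid.delete_ground] at hL
    rw [delete_singleton_eRk_eq hL] at hr
    exact hC1 L (hL.trans sdiff_subset) hr
  have hC2' : ∀ P ⊆ (M ＼ {e}).E, (M ＼ {e}).eRk P ≤ 3 → P.ncard ≤ 6 := by
    intro P hP hr
    rw [_root_.Matroid.delete_ground] at hP
    rw [delete_singleton_eRk_eq hP] at hr
    exact hC2 P (hP.trans sdiff_subset) hr
  have h2 : 2 * S₂.ncard + 3 * d' ≤ d' * d' + 6 := by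
    have hsub : S₂ ⊆ ThmN.triangles (M ＼ {e}) := by
      intro C hC
      exact ⟨_root_.Matroid.delete_isCircuit_iff.2 ⟨hC.1, disjoint_singleton_right.2 hC.2.2⟩, hC.2.1⟩
    have hle : S₂.ncard ≤ (ThmN.triangles (M ＼ {e})).ncard :=
      ncard_le_ncard hsub
        ((M ＼ {e}).ground_finite.finite_subsets.subset (fun C hC => hC.1.subset_ground))
    have := ih _ hdelE (M ＼ {e}) rfl hC1' hC2' d' (by omega) hd'enc
    omega
  subst hdd'
  nlinarith [h1', h2, h3]

/-- LEMMA T⁺⁺⁺ in the form `#(triangles M) ≤ (d·d + 6 − 3d) / 2` (`= 5 · 8 · 12 · 17 · 23` at `d = 4 … 8`). -/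
theorem ncard_triangles_le_of_nullity_sharp (M : Matroid α) [M.Finite]
    (hC1 : ∀ L ⊆ M.E, M.eRk L = 2 → L.ncard ≤ 3) (hC2 : ∀ P ⊆ M.E, M.eRk P ≤ 3 → P.ncard ≤ 6)
    {d : ℕ} (hd4 : 4 ≤ d) (hd : M.E.encard = M.eRank + d) :
    (ThmN.triangles M).ncard ≤ (d * d + 6 - 3 * d) / 2 := by
  have := two_mul_ncard_triangles_add_three_mul_le_of_four_le M hC1 hC2 hd4 hd
  omega

end S1

end PercRepro
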